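import Mathlib
import Summits.Ventures.HodgeRepro2.T5LocalFieldDictionary

/-!
# The ramified-quadratic dictionary for a pair of discrete valuation rings

Tier-5 support for the (A13) step of §N5.13.2 (route/T5-route-2.md; record table
route/T5-CHECK-N5-p4.md v3 §9).  The capstone `T5LocalFieldDictionary.even_conductor_of_dvr`
(p394509) still carries three hypotheses that the owner's prose reads off the local-field
dictionary at a RAMIFIED QUADRATIC place `E_v / F_v`:

* «f = 1» — the inertia degree of the unique prime of `O_{E_v}` over `O_{F_v}` is `1`;
* «v_E = 2 v_F on F_v», twice — `v_E(c) = exp(-2k)` for `c ∈ F_v^×` and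
  `v_E(D) = exp(-2 · v_F(D))`.

This file derives all three from the single relation `ϖ = u · π²` between the uniformisers
(the ramified reading of «e = 2»), for DVR pairs `A ⊆ B` in Mathlib's AKLB setting:

1. `map_span_eq_span_pow` / `ramificationIdx'_eq_of_algebraMap_eq_unit_mul_pow`:
   `ϖ = u · π^e` in `B` gives `(ϖ)B = (π)^e` and `ramificationIdx' (ϖ) (π) = e`;
2. the LOCAL FUNDAMENTAL IDENTITY `ramificationIdx'_mul_inertiaDeg'_eq_finrank`:
   `e · f = [L : K]` (Mathlib's `Ideal.sum_ramification_inertia` summed over the single prime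
   `IsLocalRing.primesOverFinset_eq`);
3. `inertiaDeg_eq_one_of_ramified_quadratic` (`[L:K] = 2`, `ϖ = u · π²` ⇒ `f = 1`) and
   `inertiaDeg_eq_two_of_inert_quadratic` (`[L:K] = 2`, `ϖ = u · π` ⇒ `f = 2`);
4. `val_algebraMap_eq_exp_neg_mul` / `val_algebraMap_eq_pow`: for valuations `vF` on `A`
   and `vE` on `L` normalised by `vF ϖ = exp(-1)`, `vE π = exp(-1)` and bounded by `1` on
   `A`, resp. `B`, the relation `ϖ = u · π^e` forces `vE (algebraMap a) = (vF a)^e`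
   («`v_E ∘ algebraMap = v_F^e`»), with the two `e = 2` readings
   `exists_val_algebraMap_eq_exp_neg_two_mul` and `val_algebraMap_eq_exp_neg_two_mul_log`;
5. the capstone restated, `even_conductor_of_ramified_quadratic`, with the three hypotheses
   above discharged.

Nothing here mentions a variety, a Shimura datum or an automorphic form; every statement is a
fact about discrete valuation rings.  Uses an L-value-free non-vanishing device: NO.
-/

namespace Summit.Ventures.HodgeRepro2.T5RamifiedQuadraticDictionary

open WithZero

/-! ### 1. The ramification index read off the uniformisers -/

section Ramification

variable {A B : Type*} [CommRing A] [CommRing B] [Algebra A B] [IsDomain B]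

omit [IsDomain B] in
/-- If `algebraMap ϖ = u * π ^ e` with `u` a unit of `B`, then `(ϖ) B = (π) ^ e`. -/
theorem map_span_eq_span_pow (ϖ : A) (π : B) (u : Bˣ) (e : ℕ)
    (h : algebraMap A B ϖ = u * π ^ e) :
    Ideal.map (algebraMap A B) (Ideal.span {ϖ}) = Ideal.span {π} ^ e := by
  rw [Ideal.map_span, Set.image_singleton, h, Ideal.span_singleton_mul_left_unit u.isUnit,
    Ideal.span_singleton_pow]

/-- For `π` irreducible in a domain, `(π) ^ e` is not contained in `(π) ^ (e + 1)`. -/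
theorem not_span_pow_le_span_pow_succ (π : B) (hπ : Irreducible π) (e : ℕ) :
    ¬ Ideal.span {π} ^ e ≤ Ideal.span {π} ^ (e + 1) := by
  intro hle
  rw [Ideal.span_singleton_pow, Ideal.span_singleton_pow,
    Ideal.span_singleton_le_span_singleton, pow_dvd_pow_iff hπ.ne_zero hπ.not_isUnit] at hle
  omega

/-- The ramification index of `(π)` over `(ϖ)` is the exponent in `ϖ = u * π ^ e`. -/
theorem ramificationIdx'_eq_of_algebraMap_eq_unit_mul_pow (ϖ : A) (π : B) (hπ : Irreducible π)
    (u : Bˣ) (e : ℕ) (h : algebraMap A B ϖ = u * π ^ e) :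
    (Ideal.span {ϖ}).ramificationIdx' (Ideal.span {π}) = e :=
  Ideal.ramificationIdx'_spec (map_span_eq_span_pow ϖ π u e h).le
    (by rw [map_span_eq_span_pow ϖ π u e h]; exact not_span_pow_le_span_pow_succ π hπ e)

end Ramification

/-! ### 2. The local fundamental identity `e · f = [L : K]` for a pair of DVRs -/

section FundamentalIdentity

variable (A K L B : Type*) [CommRing A] [Field K] [CommRing B] [Field L]
  [Algebra A K] [Algebra B L] [Algebra A B] [Algebra K L] [Algebra A L]
  [IsScalarTower A K L] [IsScalarTower A B L]
  [IsDomain A] [IsDiscreteValuationRing A] [IsFractionRing A K]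
  [FiniteDimensional K L] [Algebra.IsSeparable K L] [IsIntegralClosure B A L]
  [IsDomain B] [IsDiscreteValuationRing B] [IsFractionRing B L]

/-- The unique prime `(π)` of the DVR `B` above the maximal ideal `(ϖ)` of `A` satisfies
`e · f = [L : K]` — the fundamental identity with a single summand. -/
theorem ramificationIdx'_mul_inertiaDeg'_eq_finrank (ϖ : A) (hϖ : Irreducible ϖ) (π : B)
    (hπ : Irreducible π) :
    (Ideal.span {ϖ}).ramificationIdx' (Ideal.span {π}) *
      (Ideal.span {ϖ}).inertiaDeg' (Ideal.span {π}) = Module.finrank K L := by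
  haveI := T5LocalFieldDictionary.finite A K L B
  haveI : FaithfulSMul A B := (faithfulSMul_iff_algebraMap_injective A B).mpr
    (T5LocalFieldDictionary.algebraMap_injective A K L B)
  haveI := T5LocalFieldDictionary.span_isMaximal ϖ hϖ
  have hp0 : Ideal.span {ϖ} ≠ ⊥ := by
    rw [Ne, Ideal.span_singleton_eq_bot]; exact hϖ.ne_zero
  have hsum := Ideal.sum_ramification_inertia B K L (p := Ideal.span {ϖ}) hp0
  rwa [IsLocalRing.primesOverFinset_eq B hp0, Finset.sum_singleton,
    (IsDiscreteValuationRing.irreducible_iff_uniformizer π).mp hπ] at hsum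

/-- If the ramification index equals the degree, the inertia degree is `1`. -/
theorem inertiaDeg'_eq_one_of_ramificationIdx'_eq_finrank (ϖ : A) (hϖ : Irreducible ϖ) (π : B)
    (hπ : Irreducible π)
    (he : (Ideal.span {ϖ}).ramificationIdx' (Ideal.span {π}) = Module.finrank K L) :
    (Ideal.span {ϖ}).inertiaDeg' (Ideal.span {π}) = 1 := by
  have h := ramificationIdx'_mul_inertiaDeg'_eq_finrank A K L B ϖ hϖ π hπ
  rw [he] at h
  have hpos : Module.finrank K L ≠ 0 := Module.finrank_pos.ne'
  exact (Nat.mul_eq_left hpos).mp h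

/-- «f = 1 at a ramified quadratic place»: `[L : K] = 2` and `ϖ = u · π²` force the inertia
degree of `(π)` over `A` to be `1`. -/
theorem inertiaDeg_eq_one_of_ramified_quadratic (h2 : Module.finrank K L = 2)
    (ϖ : A) (hϖ : Irreducible ϖ) (π : B) (hπ : Irreducible π) (u : Bˣ)
    (hram : algebraMap A B ϖ = u * π ^ 2) :
    (Ideal.span {π}).inertiaDeg A = 1 := by
  haveI := T5LocalFieldDictionary.span_liesOver A L B π hπ ϖ hϖ
  haveI := T5LocalFieldDictionary.span_isMaximal ϖ hϖ
  haveI := T5LocalFieldDictionary.span_isMaximal π hπ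
  rw [← Ideal.inertiaDeg'_eq_inertiaDeg (Ideal.span {ϖ}) (Ideal.span {π})]
  apply inertiaDeg'_eq_one_of_ramificationIdx'_eq_finrank A K L B ϖ hϖ π hπ
  rw [ramificationIdx'_eq_of_algebraMap_eq_unit_mul_pow ϖ π hπ u 2 hram, h2]

/-- «f = 2 at an inert quadratic place»: `[L : K] = 2` and `ϖ = u · π` (the uniformiser of
`A` stays a uniformiser of `B`) force the inertia degree of `(π)` over `A` to be `2`. -/
theorem inertiaDeg_eq_two_of_inert_quadratic (h2 : Module.finrank K L = 2)
    (ϖ : A) (hϖ : Irreducible ϖ) (π : B) (hπ : Irreducible π) (u : Bˣ)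
    (hin : algebraMap A B ϖ = u * π) :
    (Ideal.span {π}).inertiaDeg A = 2 := by
  haveI := T5LocalFieldDictionary.span_liesOver A L B π hπ ϖ hϖ
  haveI := T5LocalFieldDictionary.span_isMaximal ϖ hϖ
  haveI := T5LocalFieldDictionary.span_isMaximal π hπ
  have h := ramificationIdx'_mul_inertiaDeg'_eq_finrank A K L B ϖ hϖ π hπ
  rw [ramificationIdx'_eq_of_algebraMap_eq_unit_mul_pow ϖ π hπ u 1 (by rw [pow_one]; exact hin),
    one_mul, h2, Ideal.inertiaDeg'_eq_inertiaDeg (Ideal.span {ϖ}) (Ideal.span {π})] at h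
  exact h

end FundamentalIdentity

/-! ### 3. The valuation dictionary `v_E ∘ algebraMap = v_F ^ e` -/

section Valuations

/-- In `ℤᵐ⁰`, if `a ≤ 1`, `b ≤ 1` and `a * b = 1` then `a = 1`. -/
theorem eq_one_of_mul_eq_one_of_le_one {a b : WithZero (Multiplicative ℤ)} (ha : a ≤ 1)
    (hb : b ≤ 1) (h : a * b = 1) : a = 1 := by
  refine le_antisymm ha (not_lt.mp fun hlt => ?_)
  have : a * b < 1 := calc
    a * b ≤ a * 1 := mul_le_mul_right hb a
    _ = a := mul_one a
    _ < 1 := hlt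
  exact this.ne h

variable {A B L : Type*} [CommRing A] [CommRing B] [Field L] [Algebra A B] [Algebra B L]
  [Algebra A L] [IsScalarTower A B L]

/-- A valuation on `L` bounded by `1` on `B` is `1` on the units of `B`. -/
theorem val_algebraMap_unit_eq_one (vE : Valuation L (WithZero (Multiplicative ℤ)))
    (hvE : ∀ b : B, vE (algebraMap B L b) ≤ 1) (u : Bˣ) :
    vE (algebraMap B L u) = 1 :=
  eq_one_of_mul_eq_one_of_le_one (hvE u) (hvE ↑u⁻¹)
    (by rw [← Valuation.map_mul, ← map_mul, Units.mul_inv, map_one, Valuation.map_one])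

/-- A valuation on `L` bounded by `1` on `B` is bounded by `1` on `A`. -/
theorem val_algebraMap_le_one (vE : Valuation L (WithZero (Multiplicative ℤ)))
    (hvE : ∀ b : B, vE (algebraMap B L b) ≤ 1) (a : A) : vE (algebraMap A L a) ≤ 1 := by
  rw [IsScalarTower.algebraMap_apply A B L]; exact hvE _

/-- A valuation on `A` bounded by `1` is `1` on the units of `A`. -/
theorem val_unit_eq_one (vF : Valuation A (WithZero (Multiplicative ℤ)))
    (hvF : ∀ a : A, vF a ≤ 1) (w : Aˣ) : vF w = 1 :=
  eq_one_of_mul_eq_one_of_le_one (hvF w) (hvF ↑w⁻¹)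
    (by rw [← Valuation.map_mul, Units.mul_inv, Valuation.map_one])

/-- With `vF ϖ = exp (-1)`: `vF (w * ϖ ^ n) = exp (-n)`. -/
theorem val_unit_mul_pow (vF : Valuation A (WithZero (Multiplicative ℤ)))
    (hvF : ∀ a : A, vF a ≤ 1) (ϖ : A) (hϖv : vF ϖ = exp (-1 : ℤ)) (w : Aˣ) (n : ℕ) :
    vF (w * ϖ ^ n) = exp (-(n : ℤ)) := by
  rw [Valuation.map_mul, Valuation.map_pow, val_unit_eq_one vF hvF w, hϖv, one_mul,
    ← exp_nsmul, nsmul_eq_mul, mul_neg, mul_one]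

/-- `v_E ∘ algebraMap = v_F ^ e`, exponent form: with `ϖ = u * π ^ e`, `vF ϖ = exp (-1)` and
`vE π = exp (-1)`, one has `vE (algebraMap (w * ϖ ^ n)) = exp (-(e * n))`. -/
theorem val_algebraMap_unit_mul_pow (vE : Valuation L (WithZero (Multiplicative ℤ)))
    (hvE : ∀ b : B, vE (algebraMap B L b) ≤ 1) (ϖ : A) (π : B)
    (hπv : vE (algebraMap B L π) = exp (-1 : ℤ)) (u : Bˣ) (e : ℕ)
    (h : algebraMap A B ϖ = u * π ^ e) (w : Aˣ) (n : ℕ) :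
    vE (algebraMap A L (w * ϖ ^ n)) = exp (-((e : ℤ) * n)) := by
  have hwE : vE (algebraMap A L (w : A)) = 1 :=
    eq_one_of_mul_eq_one_of_le_one (val_algebraMap_le_one vE hvE (w : A))
      (val_algebraMap_le_one vE hvE (↑w⁻¹ : A))
      (by rw [← Valuation.map_mul, ← map_mul, Units.mul_inv, map_one, Valuation.map_one])
  have hϖE : vE (algebraMap A L ϖ) = exp (-(e : ℤ)) := by
    rw [IsScalarTower.algebraMap_apply A B L, h, map_mul, map_pow, Valuation.map_mul,
      Valuation.map_pow, val_algebraMap_unit_eq_one vE hvE u, hπv, one_mul, ← exp_nsmul,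
      nsmul_eq_mul, mul_neg, mul_one]
  rw [map_mul, map_pow, Valuation.map_mul, Valuation.map_pow, hwE, hϖE, one_mul, ← exp_nsmul,
    nsmul_eq_mul, mul_neg, mul_comm]

variable [IsDomain A] [IsDiscreteValuationRing A]

/-- Every non-zero `a : A` has `vF a = exp (-n)` for the exponent `n` of `ϖ` in `a`. -/
theorem exists_val_eq_exp_neg (vF : Valuation A (WithZero (Multiplicative ℤ)))
    (hvF : ∀ a : A, vF a ≤ 1) (ϖ : A) (hϖ : Irreducible ϖ) (hϖv : vF ϖ = exp (-1 : ℤ))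
    (a : A) (ha : a ≠ 0) : ∃ n : ℕ, vF a = exp (-(n : ℤ)) := by
  obtain ⟨n, w, rfl⟩ := IsDiscreteValuationRing.eq_unit_mul_pow_irreducible ha hϖ
  exact ⟨n, val_unit_mul_pow vF hvF ϖ hϖv w n⟩

/-- `v_F` does not vanish on non-zero elements of the DVR `A`. -/
theorem val_ne_zero (vF : Valuation A (WithZero (Multiplicative ℤ)))
    (hvF : ∀ a : A, vF a ≤ 1) (ϖ : A) (hϖ : Irreducible ϖ) (hϖv : vF ϖ = exp (-1 : ℤ))
    (a : A) (ha : a ≠ 0) : vF a ≠ 0 := by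
  obtain ⟨n, hn⟩ := exists_val_eq_exp_neg vF hvF ϖ hϖ hϖv a ha
  rw [hn]; exact exp_ne_zero

/-- «`v_E ∘ algebraMap = v_F ^ e`»: `vE (algebraMap a) = (vF a) ^ e` for every non-zero `a : A`. -/
theorem val_algebraMap_eq_pow (vF : Valuation A (WithZero (Multiplicative ℤ)))
    (hvF : ∀ a : A, vF a ≤ 1) (ϖ : A) (hϖ : Irreducible ϖ) (hϖv : vF ϖ = exp (-1 : ℤ))
    (vE : Valuation L (WithZero (Multiplicative ℤ)))
    (hvE : ∀ b : B, vE (algebraMap B L b) ≤ 1) (π : B)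
    (hπv : vE (algebraMap B L π) = exp (-1 : ℤ)) (u : Bˣ) (e : ℕ)
    (h : algebraMap A B ϖ = u * π ^ e) (a : A) (ha : a ≠ 0) :
    vE (algebraMap A L a) = vF a ^ e := by
  obtain ⟨n, w, rfl⟩ := IsDiscreteValuationRing.eq_unit_mul_pow_irreducible ha hϖ
  rw [val_algebraMap_unit_mul_pow vE hvE ϖ π hπv u e h w n, val_unit_mul_pow vF hvF ϖ hϖv w n,
    ← exp_nsmul, nsmul_eq_mul, mul_neg, mul_comm]

/-- `v_E ∘ algebraMap = v_F ^ e`, logarithmic form: `vE (algebraMap a) = exp (-(e · ord_F a))`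
with `ord_F a = -log (vF a)`. -/
theorem val_algebraMap_eq_exp_neg_mul (vF : Valuation A (WithZero (Multiplicative ℤ)))
    (hvF : ∀ a : A, vF a ≤ 1) (ϖ : A) (hϖ : Irreducible ϖ) (hϖv : vF ϖ = exp (-1 : ℤ))
    (vE : Valuation L (WithZero (Multiplicative ℤ)))
    (hvE : ∀ b : B, vE (algebraMap B L b) ≤ 1) (π : B)
    (hπv : vE (algebraMap B L π) = exp (-1 : ℤ)) (u : Bˣ) (e : ℕ)
    (h : algebraMap A B ϖ = u * π ^ e) (a : A) (ha : a ≠ 0) :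
    vE (algebraMap A L a) = exp (-((e : ℤ) * (-(vF a).log))) := by
  obtain ⟨n, w, rfl⟩ := IsDiscreteValuationRing.eq_unit_mul_pow_irreducible ha hϖ
  rw [val_algebraMap_unit_mul_pow vE hvE ϖ π hπv u e h w n, val_unit_mul_pow vF hvF ϖ hϖv w n,
    log_exp, neg_neg]

end Valuations

/-! ### 4. The two «`v_E = 2 v_F`» readings of the capstone -/

section Quadratic

variable {A K L B : Type*} [CommRing A] [Field K] [CommRing B] [Field L]
  [Algebra A K] [Algebra B L] [Algebra A B] [Algebra K L] [Algebra A L]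
  [IsScalarTower A K L] [IsScalarTower A B L]
  [IsDomain A] [IsDiscreteValuationRing A] [IsFractionRing A K]

/-- First reading: for `c ∈ K^×`, `vE c = exp (-2k)` for some integer `k`. -/
theorem exists_val_algebraMap_eq_exp_neg_two_mul (ϖ : A) (hϖ : Irreducible ϖ)
    (vE : Valuation L (WithZero (Multiplicative ℤ)))
    (hvE : ∀ b : B, vE (algebraMap B L b) ≤ 1) (π : B)
    (hπv : vE (algebraMap B L π) = exp (-1 : ℤ)) (u : Bˣ)
    (hram : algebraMap A B ϖ = u * π ^ 2) (c : K) (hc : c ≠ 0) :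
    ∃ k : ℤ, vE (algebraMap K L c) = exp (-(2 * k)) := by
  obtain ⟨x, y, hy, rfl⟩ := IsFractionRing.div_surjective A c
  have hy0 : y ≠ 0 := nonZeroDivisors.ne_zero hy
  have hx0 : x ≠ 0 := by
    rintro rfl
    simp at hc
  obtain ⟨m, w, rfl⟩ := IsDiscreteValuationRing.eq_unit_mul_pow_irreducible hx0 hϖ
  obtain ⟨n, w', rfl⟩ := IsDiscreteValuationRing.eq_unit_mul_pow_irreducible hy0 hϖ
  refine ⟨(m : ℤ) - n, ?_⟩
  rw [map_div₀, Valuation.map_div, ← IsScalarTower.algebraMap_apply A K L,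
    ← IsScalarTower.algebraMap_apply A K L,
    val_algebraMap_unit_mul_pow vE hvE ϖ π hπv u 2 hram w m,
    val_algebraMap_unit_mul_pow vE hvE ϖ π hπv u 2 hram w' n, ← exp_sub]
  congr 1
  push_cast
  ring

omit [IsFractionRing A K] in
/-- Second reading: `vE D = exp (-2 · ord_F D)` with `ord_F D = -log (vF D)`, for `D ≠ 0`. -/
theorem val_algebraMap_eq_exp_neg_two_mul_log (vF : Valuation A (WithZero (Multiplicative ℤ)))
    (hvF : ∀ a : A, vF a ≤ 1) (ϖ : A) (hϖ : Irreducible ϖ) (hϖv : vF ϖ = exp (-1 : ℤ))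
    (vE : Valuation L (WithZero (Multiplicative ℤ)))
    (hvE : ∀ b : B, vE (algebraMap B L b) ≤ 1) (π : B)
    (hπv : vE (algebraMap B L π) = exp (-1 : ℤ)) (u : Bˣ)
    (hram : algebraMap A B ϖ = u * π ^ 2) (D : A) (hD : D ≠ 0) :
    vE (algebraMap K L (algebraMap A K D)) = exp (-(2 * -(vF D).log)) := by
  rw [← IsScalarTower.algebraMap_apply A K L]
  have := val_algebraMap_eq_exp_neg_mul vF hvF ϖ hϖ hϖv vE hvE π hπv u 2 hram D hD
  rw [this]
  push_cast
  ring_nf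

end Quadratic

/-! ### 5. The capstone restated for a ramified quadratic DVR pair -/

section Capstone

variable (A K L B : Type*) [CommRing A] [Field K] [CommRing B] [Field L]
  [Algebra A K] [Algebra B L] [Algebra A B] [Algebra K L] [Algebra A L]
  [IsScalarTower A K L] [IsScalarTower A B L]
  [IsDomain A] [IsDiscreteValuationRing A] [IsFractionRing A K]
  [FiniteDimensional K L] [Algebra.IsSeparable K L] [IsIntegralClosure B A L]
  [IsDomain B] [IsDiscreteValuationRing B] [IsFractionRing B L]
  [PerfectField (FractionRing A)] [Module.IsTorsionFree A B]

/-- The (A13) capstone `T5LocalFieldDictionary.even_conductor_of_dvr` with «f = 1» and the two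
«v_E = 2 v_F» hypotheses DISCHARGED from the single relation `ϖ = u · π²` (the ramified reading
of `e = 2`).  Remaining hypotheses: the AKLB setting for the DVR pair `A ⊆ B` (`B` the integral
closure of `A` in the separable quadratic `L / K`), uniformisers `ϖ`, `π` with `ϖ = u · π²`,
`𝔇 = (π ^ d)`, valuations `vF` on `A` and `vE` on `L` bounded by `1` on `A` resp. `B` and
normalised on the uniformisers, `√D = s ∈ B ∖ A` with `vF D ≠ 0` and `vF 2 ≠ 0`, and
`δ = c · √D`.  Conclusion: `2 n + ord_E δ + d` is even for every integer `n`. -/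
theorem even_conductor_of_ramified_quadratic (h2 : Module.finrank K L = 2)
    (π : B) (hπ : Irreducible π) (ϖ : A) (hϖ : Irreducible ϖ) (u : Bˣ)
    (hram : algebraMap A B ϖ = u * π ^ 2)
    (d : ℕ) (hd : differentIdeal A B = Ideal.span {π ^ d})
    (vF : Valuation A (WithZero (Multiplicative ℤ))) (hvF : ∀ a : A, vF a ≤ 1)
    (hϖv : vF ϖ = exp (-1 : ℤ))
    (vE : Valuation L (WithZero (Multiplicative ℤ))) (hvE : ∀ b : B, vE (algebraMap B L b) ≤ 1)
    (hπv : vE (algebraMap B L π) = exp (-1 : ℤ))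
    (s : B) (D : A) (hs : s * s = algebraMap A B D) (hs' : s ∉ Set.range (algebraMap A B))
    (hD : vF D ≠ 0) (h2v : vF 2 ≠ 0)
    (δ : L) (c : K) (hc : c ≠ 0) (hδ : δ = algebraMap K L c * algebraMap B L s) (n : ℤ) :
    Even (2 * n + T5RamifiedParity.ord vE δ + d) := by
  have hD0 : D ≠ 0 := by
    rintro rfl
    exact hD (Valuation.map_zero vF)
  obtain ⟨k, hk⟩ := exists_val_algebraMap_eq_exp_neg_two_mul (A := A) (B := B) ϖ hϖ
    vE hvE π hπv u hram c hc
  exact T5LocalFieldDictionary.even_conductor_of_dvr A K L B h2 π hπ ϖ hϖ d hd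
    (inertiaDeg_eq_one_of_ramified_quadratic A K L B h2 ϖ hϖ π hπ u hram) vF hvF hϖv s D hs hs'
    hD h2v vE δ c hc hδ k hk
    (val_algebraMap_eq_exp_neg_two_mul_log (B := B) vF hvF ϖ hϖ hϖv vE hvE π hπv u hram D hD0) n

end Capstone

end Summit.Ventures.HodgeRepro2.T5RamifiedQuadraticDictionary
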